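import Literature.MathematicalPhysics.QuantumFieldTheory.Balaban1983to89.B9Eq3132Whole
import Literature.MathematicalPhysics.QuantumFieldTheory.Balaban1983to89.B9GeoLemma21KLevelV1
import Literature.MathematicalPhysics.QuantumFieldTheory.Balaban1983to89.B4Sect5Proof

/-!
# `Balaban1983to89.B9Eq3132CTInputs` — [B9] (3.132) p. 422: the Combes–Thomas input schema `B9Eq3132Whole.CTInputs` of
# the whole leaf `B9.Stmt3132Printed` REDUCED to coercivity + decay of the normalised matrix, the weighted-sums half
# CERTIFIED from [4] Lemma 2.1 (2.61) — and DISCHARGED down to those two at the record geometry `geo9Y`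

T. Bałaban, *Propagators for lattice gauge theories in a background field*, Commun. Math. Phys. **99** (1985) 389–434
[`Balaban1985BackgroundPropagators`, "B9"]; [4] = T. Bałaban, *Propagators and renormalization transformations for lattice
gauge theories. II*, Commun. Math. Phys. **96** (1984) 223–250 [`Balaban1984PropagatorsII`].

statement-level skeleton of published theorems with citation tags; proofs where landed; nothing here is a claim about the
Yang–Mills mass gap

THE PRINTED LOCUS (verbatim, p. 422 [PDF 34], before Theorem 3.12).  *"The operators (QGQ\*)^{−1}, or (QG₁Q\*)^{−1}, can be
analyzed in the same way as the operator (Q′G′²Q′\*)^{−1}. We will not repeat these considerations here, let us write only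
bounds. We have |(QGQ\*)^{−1}(y, y′)| ≤ O(1)(L^jη)^{−2}(L^{j′}η)^{−d}e^{−δ₁d(y,y′)} for y ∈ Λ_j, y′ ∈ Λ_{j′}, (3.132)"* (cell census
GAPS G-B9-15 «by analogy»).

THE POINT.  Row 26 of the N06 knit (`B9.Stmt3132Printed`, N06-ASSIGNMENT v1) is inhabited by
`B9Eq3132Whole.stmt3132Printed_of_coercive` (p462308) from the cell's written Combes–Thomas repair route
(`QGQInverse.inverse_decay`): its analytic input is the schema `B9Eq3132Whole.CTInputs c35 geo bg S` — under the printed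
prefix of Theorem 3.12 (M ≧ M₄, 0 < α₀, Mα₀ ≦ a₀, U in (3.35) ∩ (3.36)) the normalised matrix `S i U` of (QGQ\*)(U) is
COERCIVE with γ AND its (e^{κd} − 1)-weighted absolute row and column sums are ≦ ρ < γ for some κ > 0.  The knit at the
record (`…N06AtRecord11ObligationsPins2.s3132_of_inputs`) displays this composite schema twice (`hCT`, `hCT₁`).  Its second
half is NOT an independent input: it is elementary bookkeeping from an exponential DECAY of the normalised kernel
(`|S(y, y′)| ≦ B e^{−δd(y,y′)}` — the shape Theorem 3.3 for G plus the scale transfer [4] (2.60) deliver for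
D^{−1}W^{1/2}(QGQ\*)W^{1/2}D^{−1}, `QGQInverse` docstring input II.a) together with the row-sum bound [4] Lemma 2.1 (2.61),
and (2.61) with a generic constant is a THEOREM at the record geometry (`B9GeoLemma21KLevelV1.rowSum261_geo9Y`, p467804).
THIS FILE types that reduction:

* §1 the two located input schemas under the printed prefix — `CoerciveUnder c35 geo bg S` (∃ M₄, a₀, γ > 0: `QGQInverse.Coercive
  (S i U) γ`; the written repair obtains it from Theorem 3.11-type positivity by the variational device
  `QGQInverse.qgq_coercive_of_approx_right_inverse`) and `DecayUnder c35 geo bg S` (∃ M₅, a₅, B ≧ 0, δ > 0: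
  `|S i U y y′| ≦ B·e^{−δd(y,y′)}`).  HYPOTHESES — neither is in the tree for Bałaban's operators.
* §2 one member, one configuration — `weightedRowSum_le_of_decay` ∕ `weightedColSum_le_of_decay`: for d ≧ 0 (and d symmetric
  for the columns), decay (B, δ), 0 ≦ κ ≦ ¼δ and Σ_{y′} e^{−½δd(y,y′)} ≦ c give Σ_{y′}|S(y, y′)|(e^{κd(y,y′)} − 1) ≦ κ·B(4∕δ)c —
  the pointwise step `e^{−δt}(e^{κt} − 1) ≦ κ(4∕δ)e^{−½δt}` is `B4Sect5Proof.exp_weight_le` (unit pv23, reused, not restated).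
* §3 ★ `ctInputs_of_coercive_decay` — over ANY family: d ≧ 0, d symmetric, `B9Ineq349Whole.RowSum261 geo`, `CoerciveUnder`,
  `DecayUnder` ⟹ `CTInputs c35 geo bg S`, with the explicit choices κ := min(¼δ, γ∕(2(W + 1))), W := B(4∕δ)max(c, 0),
  ρ := ½γ, M₄′ := max(max M₄ M₅, M_L(½δ)), a₀′ := min a₀ a₅ (private arithmetic `rate_mul_le_half`: κW ≦ ½γ).
* §4 ★ `ctInputs_geo9Y_of_coercive_decay` — AT THE RECORD GEOMETRY `geo9Y` of Stage 3′(Y) (any backgrounds record `bg`, any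
  `c35`, any normalised matrices `S`, any `Fintype` instance on the sites as the knit binds it): `CoerciveUnder → DecayUnder →
  CTInputs`, the three geometric facts DISCHARGED by `geo9K_dist_nonneg'`, `geo9Y_dist_comm`, `rowSum261_geo9Y`.  Effect on
  the knit: `hCT := ctInputs_geo9Y_of_coercive_decay hco hdec` (and the same for QG₁Q\*) — two composite binders become
  four binders of located printed shape, the weighted-sums half certified.
* §5 ★ `stmt3132Printed_geo9Y_of_coercive_decay` — ROW 26's WHOLE PRINTED LEAF AT THE RECORD GEOMETRY for the symmetric
  normalisation w(y) = (Lʲη)^{−(1+d′∕2)}: `B9.Stmt3132Printed d′ c35 geo9Y bg QGQinv QG₁Qinv` from SIX located binders only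
  (`CoerciveUnder`∕`DecayUnder` for S and S₁, `InvNormalised` for the two kernels) — §4 + p462308 + p468507's
  `hwt_symm_geo9Y`∕`symmA_pos` + the carrier facts; the knit's one-call form of row 26.

HONEST SCOPE.  Nothing of print is asserted and print's own route («the same way as (Q′G′²Q′\*)^{−1}») is not typed; the
coercivity and the decay of the normalised matrices REMAIN HYPOTHESES (named, located: Thm 3.11 p. 416 ∕ Thm 3.3 p. 399 +
[4] (2.60)); what is certified is the elementary half of the written repair's input plus its feeding by the PROVED (2.61) of
the record geometry.  Value: kernel-checked bookkeeping — NOT a node discharge, NOT summit progress; one finite lattice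
programme; nothing continuum, nothing about the mass gap.  Cell `pub-ymgap` (HUMAN RULING D-0062), Track A node N06 [B9],
N06-ASSIGNMENT v1 row 26 (bundle F4), seat `pub-ymgap-dag-n06-i` gen 3, 2026-08-26.
-/

namespace Literature.MathematicalPhysics.QuantumFieldTheory.Balaban1983to89.B9Eq3132CTInputs

open QGQInverse (Coercive)
open B9Eq3132Whole (CTInputs)
open B9Ineq349Whole (RowSum261)

noncomputable section

/-! ## §1 The two located inputs under the printed prefix of Theorem 3.12 -/

section FamilySchemas

variable {I : Type}

/-- **COERCIVITY OF THE NORMALISED MATRIX UNDER THE PRINTED PREFIX OF THEOREM 3.12** (p. 423: *"If an external gauge field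
configuration U satisfies both regularity conditions (3.35), (3.36) for α₀ sufficiently small"*; «M sufficiently large» inherited):
there are M₄, a₀ > 0 and γ > 0 such that for every member with M ≧ M₄, every 0 < α₀ with Mα₀ ≦ a₀ and every U in (3.35) ∩ (3.36)
the normalised matrix `S i U` of (QGQ\*)(U) (or of (QG₁Q\*)(U)) is `QGQInverse.Coercive` with γ — the written repair's energy input
(from Theorem 3.11-type positivity by `QGQInverse.qgq_coercive_of_approx_right_inverse`).  HYPOTHESIS SCHEMA; = the first conjunct
of `B9Eq3132Whole.CTInputs`. [cite: Balaban1985BackgroundPropagators, (3.132) p.422 + Thm 3.12 p.423 (prefix) + Thm 3.11 p.416] -/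
def CoerciveUnder (c35 : ℝ) (geo : I → B9.Geometry) (bg : I → B9.Backgrounds) [∀ i, Fintype (geo i).Site]
    (S : ∀ i, (bg i).Cfg → Matrix (geo i).Site (geo i).Site ℝ) : Prop :=
  ∃ M₄ a₀ γ : ℝ, 0 < M₄ ∧ 0 < a₀ ∧ 0 < γ ∧
    ∀ i : I, M₄ ≤ (geo i).M → ∀ α₀ : ℝ, 0 < α₀ → (geo i).M * α₀ ≤ a₀ →
      ∀ U : (bg i).Cfg, (bg i).Reg335 c35 α₀ U → (bg i).Reg336 c35 α₀ U → Coercive (S i U) γ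

/-- **EXPONENTIAL DECAY OF THE NORMALISED MATRIX UNDER THE PRINTED PREFIX OF THEOREM 3.12**: there are M₅, a₅ > 0, B ≧ 0 and
δ > 0 such that for every member with M ≧ M₅, every 0 < α₀ with Mα₀ ≦ a₅ and every U in (3.35) ∩ (3.36),
`|S i U y y′| ≦ B·e^{−δ d(y,y′)}` for all coarse y, y′ — the shape Theorem 3.3's bounds for G(U) and the scale transfer [4] (2.60)
give for D^{−1}W^{1/2}(QGQ\*)W^{1/2}D^{−1} (the powers of L^jη absorbed by the normalisation; `QGQInverse` docstring, input II.a).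
HYPOTHESIS SCHEMA. [cite: Balaban1985BackgroundPropagators, (3.132) p.422 + Thm 3.3 p.399 + Thm 3.12 p.423 (prefix); Balaban1984PropagatorsII, Lemma 2.1 (2.60) p.234] -/
def DecayUnder (c35 : ℝ) (geo : I → B9.Geometry) (bg : I → B9.Backgrounds)
    (S : ∀ i, (bg i).Cfg → Matrix (geo i).Site (geo i).Site ℝ) : Prop :=
  ∃ M₅ a₅ B δ : ℝ, 0 < M₅ ∧ 0 < a₅ ∧ 0 ≤ B ∧ 0 < δ ∧
    ∀ i : I, M₅ ≤ (geo i).M → ∀ α₀ : ℝ, 0 < α₀ → (geo i).M * α₀ ≤ a₅ →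
      ∀ U : (bg i).Cfg, (bg i).Reg335 c35 α₀ U → (bg i).Reg336 c35 α₀ U →
        ∀ y y' : (geo i).Site, |S i U y y'| ≤ B * Real.exp (-(δ * (geo i).dist y y'))

end FamilySchemas

/-! ## §2 Weighted sums from decay, one member and one configuration -/

section OneU

variable {g : B9.Geometry} [Fintype g.Site]

/-- **WEIGHTED ROW SUMS FROM DECAY + (2.61)**: for a distance d ≧ 0, a matrix with `|S(y, y′)| ≦ B e^{−δd(y,y′)}` (B ≧ 0, δ > 0), a
rate 0 ≦ κ ≦ ¼δ and the row-sum bound Σ_{y′} e^{−½δ d(y,y′)} ≦ c at y, the (e^{κd} − 1)-weighted absolute row sum at y is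
≦ κ·(B(4∕δ)c).  Pointwise step `e^{−δt}(e^{κt} − 1) ≦ κ(4∕δ)e^{−½δt}` = `B4Sect5Proof.exp_weight_le`.
[cite: Balaban1984PropagatorsII, Lemma 2.1 (2.61) p.234; Balaban1985BackgroundPropagators, (3.132) p.422 (bookkeeping of the Combes–Thomas input)] -/
theorem weightedRowSum_le_of_decay (S : Matrix g.Site g.Site ℝ) {B δ κ c : ℝ} (hB : 0 ≤ B) (hδ : 0 < δ) (hκ0 : 0 ≤ κ)
    (hκ : κ ≤ δ / 4) (hdist : ∀ y y' : g.Site, 0 ≤ g.dist y y')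
    (hS : ∀ y y' : g.Site, |S y y'| ≤ B * Real.exp (-(δ * g.dist y y'))) (y : g.Site)
    (h261 : ∑ y' : g.Site, Real.exp (-(δ / 2 * g.dist y y')) ≤ c) :
    ∑ y' : g.Site, |S y y'| * (Real.exp (κ * g.dist y y') - 1) ≤ κ * (B * (4 / δ) * c) := by
  have step : ∀ y' : g.Site, |S y y'| * (Real.exp (κ * g.dist y y') - 1) ≤
      B * (κ * (4 / δ)) * Real.exp (-(δ / 2 * g.dist y y')) := by
    intro y'
    have hn0 : 0 ≤ g.dist y y' := hdist y y'
    have hw : 0 ≤ Real.exp (κ * g.dist y y') - 1 := by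
      have h1 : (1 : ℝ) ≤ Real.exp (κ * g.dist y y') := Real.one_le_exp (mul_nonneg hκ0 hn0)
      linarith
    calc |S y y'| * (Real.exp (κ * g.dist y y') - 1)
        ≤ B * Real.exp (-(δ * g.dist y y')) * (Real.exp (κ * g.dist y y') - 1) :=
          mul_le_mul_of_nonneg_right (hS y y') hw
      _ = B * (Real.exp (-(δ * g.dist y y')) * (Real.exp (κ * g.dist y y') - 1)) := by ring
      _ ≤ B * (κ * (4 / δ) * Real.exp (-(δ / 2 * g.dist y y'))) :=
          mul_le_mul_of_nonneg_left (B4Sect5Proof.exp_weight_le hδ hκ0 hκ hn0) hB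
      _ = B * (κ * (4 / δ)) * Real.exp (-(δ / 2 * g.dist y y')) := by ring
  have hpref : 0 ≤ B * (κ * (4 / δ)) := mul_nonneg hB (mul_nonneg hκ0 (div_nonneg (by norm_num) hδ.le))
  calc ∑ y' : g.Site, |S y y'| * (Real.exp (κ * g.dist y y') - 1)
      ≤ ∑ y' : g.Site, B * (κ * (4 / δ)) * Real.exp (-(δ / 2 * g.dist y y')) := Finset.sum_le_sum fun y' _ => step y'
    _ = B * (κ * (4 / δ)) * ∑ y' : g.Site, Real.exp (-(δ / 2 * g.dist y y')) := by rw [Finset.mul_sum]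
    _ ≤ B * (κ * (4 / δ)) * c := mul_le_mul_of_nonneg_left h261 hpref
    _ = κ * (B * (4 / δ) * c) := by ring

/-- **WEIGHTED COLUMN SUMS FROM DECAY + (2.61)**, by the symmetry of the distance ([4] (2.46) is symmetric): the same bound for
Σ_y |S(y, y′)|(e^{κd(y,y′)} − 1) at y′ from the row-sum bound Σ_y e^{−½δ d(y′,y)} ≦ c at y′.
[cite: Balaban1984PropagatorsII, Lemma 2.1 (2.61) p.234 + (2.46) p.231; Balaban1985BackgroundPropagators, (3.132) p.422 (bookkeeping)] -/
theorem weightedColSum_le_of_decay (S : Matrix g.Site g.Site ℝ) {B δ κ c : ℝ} (hB : 0 ≤ B) (hδ : 0 < δ) (hκ0 : 0 ≤ κ)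
    (hκ : κ ≤ δ / 4) (hdist : ∀ y y' : g.Site, 0 ≤ g.dist y y') (hsymm : ∀ y y' : g.Site, g.dist y y' = g.dist y' y)
    (hS : ∀ y y' : g.Site, |S y y'| ≤ B * Real.exp (-(δ * g.dist y y'))) (y' : g.Site)
    (h261 : ∑ y : g.Site, Real.exp (-(δ / 2 * g.dist y' y)) ≤ c) :
    ∑ y : g.Site, |S y y'| * (Real.exp (κ * g.dist y y') - 1) ≤ κ * (B * (4 / δ) * c) := by
  have hSt : ∀ a b : g.Site, |S.transpose a b| ≤ B * Real.exp (-(δ * g.dist a b)) := by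
    intro a b
    rw [Matrix.transpose_apply, hsymm]
    exact hS b a
  have h := weightedRowSum_le_of_decay S.transpose hB hδ hκ0 hκ hdist hSt y' h261
  calc ∑ y : g.Site, |S y y'| * (Real.exp (κ * g.dist y y') - 1)
      = ∑ y : g.Site, |S.transpose y' y| * (Real.exp (κ * g.dist y' y) - 1) := by
        refine Finset.sum_congr rfl fun y _ => ?_
        rw [Matrix.transpose_apply, hsymm]
    _ ≤ κ * (B * (4 / δ) * c) := h

end OneU

/-! ## §3 `CTInputs` from coercivity + decay + (2.61), over any family -/

section Family

variable {I : Type} {c35 : ℝ} {geo : I → B9.Geometry} {bg : I → B9.Backgrounds} [∀ i, Fintype (geo i).Site]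

omit [∀ i, Fintype (geo i).Site] in
/-- Arithmetic of the rate choice: for γ > 0, W ≧ 0 and κ ≦ γ∕(2(W + 1)), κ·W ≦ ½γ. [folklore] -/
private theorem rate_mul_le_half {γ W κ : ℝ} (hγ : 0 < γ) (hW : 0 ≤ W) (hκ : κ ≤ γ / (2 * (W + 1))) : κ * W ≤ γ / 2 := by
  have h2 : 0 < 2 * (W + 1) := by positivity
  have h1 : κ * W ≤ γ / (2 * (W + 1)) * W := mul_le_mul_of_nonneg_right hκ hW
  have h3 : γ / (2 * (W + 1)) * W ≤ γ / 2 := by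
    rw [div_mul_eq_mul_div, div_le_iff₀ h2]
    have e : γ / 2 * (2 * (W + 1)) = γ * W + γ := by ring
    rw [e]
    linarith
  exact h1.trans h3

/-- ★ **`CTInputs` FROM COERCIVITY + DECAY + (2.61)** — the Combes–Thomas input schema of `B9Eq3132Whole.stmt3132Printed_of_coercive`
REDUCED: over any family whose distances are ≧ 0 and symmetric, `CoerciveUnder c35 geo bg S` (γ), `DecayUnder c35 geo bg S` (B, δ)
and [4] (2.61) with a generic constant at every rate under an M-threshold (`B9Ineq349Whole.RowSum261 geo`, here used at the rate
½δ: M ≧ M_L, constant c) give `B9Eq3132Whole.CTInputs c35 geo bg S` with the explicit witnesses M₄′ := max(max M₄ M₅, M_L),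
a₀′ := min a₀ a₅, γ, ρ := ½γ, κ := min(¼δ, γ∕(2(W + 1))) where W := B(4∕δ)max(c, 0): by §2 every weighted row∕column sum is
≦ κW ≦ ½γ < γ.  Nothing of print asserted; the two located inputs stay hypotheses.
[cite: Balaban1985BackgroundPropagators, (3.132) p.422 + Thm 3.12 p.423 (prefix); Balaban1984PropagatorsII, Lemma 2.1 (2.61) p.234] -/
theorem ctInputs_of_coercive_decay {S : ∀ i, (bg i).Cfg → Matrix (geo i).Site (geo i).Site ℝ}
    (hdist : ∀ (i : I) (y y' : (geo i).Site), 0 ≤ (geo i).dist y y')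
    (hsymm : ∀ (i : I) (y y' : (geo i).Site), (geo i).dist y y' = (geo i).dist y' y)
    (h261 : RowSum261 geo) (hco : CoerciveUnder c35 geo bg S) (hdec : DecayUnder c35 geo bg S) :
    CTInputs c35 geo bg S := by
  obtain ⟨M₄, a₀, γ, hM₄, ha₀, hγ, Hco⟩ := hco
  obtain ⟨M₅, a₅, B, δ, hM₅, ha₅, hB, hδ, Hdec⟩ := hdec
  obtain ⟨ML, c, H61⟩ := h261 (δ / 2) (half_pos hδ)
  -- the (2.61) constant floored at 0, the smallness constant W and the rate κ
  set c' : ℝ := max c 0 with hc'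
  have hc'0 : 0 ≤ c' := le_max_right _ _
  set W : ℝ := B * (4 / δ) * c' with hW
  have hW0 : 0 ≤ W := mul_nonneg (mul_nonneg hB (div_nonneg (by norm_num) hδ.le)) hc'0
  set κ : ℝ := min (δ / 4) (γ / (2 * (W + 1))) with hκ
  have hκpos : 0 < κ := lt_min (by positivity) (div_pos hγ (by positivity))
  have hκ4 : κ ≤ δ / 4 := min_le_left _ _
  have hκW : κ * W ≤ γ / 2 := rate_mul_le_half hγ hW0 (min_le_right _ _)
  refine ⟨max (max M₄ M₅) ML, min a₀ a₅, γ, γ / 2, κ,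
    lt_max_of_lt_left (lt_max_of_lt_left hM₄), lt_min ha₀ ha₅, by linarith, hκpos, ?_⟩
  intro i hM α₀ hα₀ hMa U hU hU'
  have hM₄i : M₄ ≤ (geo i).M := le_trans (le_trans (le_max_left _ _) (le_max_left _ _)) hM
  have hM₅i : M₅ ≤ (geo i).M := le_trans (le_trans (le_max_right _ _) (le_max_left _ _)) hM
  have hMLi : ML ≤ (geo i).M := le_trans (le_max_right _ _) hM
  have hcoU : Coercive (S i U) γ := Hco i hM₄i α₀ hα₀ (le_trans hMa (min_le_left _ _)) U hU hU'
  have hdecU : ∀ y y' : (geo i).Site, |S i U y y'| ≤ B * Real.exp (-(δ * (geo i).dist y y')) :=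
    Hdec i hM₅i α₀ hα₀ (le_trans hMa (min_le_right _ _)) U hU hU'
  have h61 : ∀ y : (geo i).Site, ∑ y' : (geo i).Site, Real.exp (-(δ / 2 * (geo i).dist y y')) ≤ c' :=
    fun y => (H61 i hMLi y).trans (le_max_left _ _)
  refine ⟨hcoU, fun y => ?_, fun y' => ?_⟩
  · exact (weightedRowSum_le_of_decay (S i U) hB hδ hκpos.le hκ4 (hdist i) hdecU y (h61 y)).trans hκW
  · exact (weightedColSum_le_of_decay (S i U) hB hδ hκpos.le hκ4 (hdist i) (hsymm i) hdecU y' (h61 y')).trans hκW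

end Family

/-! ## §4 At the record geometry `geo9Y`: the three geometric facts discharged -/

section Record

open B9PinMembersKLevelV1 (MemberY geo9Y)
open B9GeoLemma21KLevelV1 (rowSum261_geo9Y geo9Y_dist_comm geo9K_dist_nonneg' geo9Y_dist_self geo9Y_dist_triangle
  geo9Y_len_pos hwt_symm_geo9Y symmA_pos)
open B9Eq3132Whole (InvNormalised stmt3132Printed_of_coercive)

variable {d ℓ : ℕ} {hd : 1 ≤ d + 1} {hL : Odd (ℓ + 1) ∧ 1 < ℓ + 1} {b₀ b₁ : ℝ} {Mstar : ℕ}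

/-- ★ **ROW 26's COMBES–THOMAS INPUT AT THE RECORD GEOMETRY, DOWN TO COERCIVITY + DECAY**: over the members `MemberY` of Stage 3′(Y)
with their realised (2.46)-geometry `geo9Y` (ANY backgrounds record `bg`, ANY `c35`, ANY family of normalised matrices `S`, ANY
`Fintype` instance on the coarse sites as the knit binds it), `CoerciveUnder c35 geo9Y bg S → DecayUnder c35 geo9Y bg S →
CTInputs c35 geo9Y bg S`; d ≧ 0 and d symmetric are facts of the k-level torus distance (`geo9K_dist_nonneg'`, `geo9Y_dist_comm`) and
(2.61) at every rate is `rowSum261_geo9Y`.  In the N06 knit: `hCT := ctInputs_geo9Y_of_coercive_decay hco hdec`.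
[cite: Balaban1985BackgroundPropagators, (3.132) p.422; Balaban1984PropagatorsII, Lemma 2.1 (2.61) p.234, (2.46) p.231] -/
theorem ctInputs_geo9Y_of_coercive_decay [∀ x : MemberY d ℓ hd hL b₀ b₁ Mstar, Fintype (geo9Y x).Site] {c35 : ℝ}
    {bg : MemberY d ℓ hd hL b₀ b₁ Mstar → B9.Backgrounds}
    {S : ∀ x : MemberY d ℓ hd hL b₀ b₁ Mstar, (bg x).Cfg → Matrix (geo9Y x).Site (geo9Y x).Site ℝ}
    (hco : CoerciveUnder c35 geo9Y bg S) (hdec : DecayUnder c35 geo9Y bg S) :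
    CTInputs c35 (geo9Y (d := d) (ℓ := ℓ) (hd := hd) (hL := hL) (b₀ := b₀) (b₁ := b₁) (Mstar := Mstar)) bg S :=
  ctInputs_of_coercive_decay (fun x y y' => geo9K_dist_nonneg' x.toKIdx y y') (fun x y y' => geo9Y_dist_comm x y y')
    rowSum261_geo9Y hco hdec

/-! ## §5 Row 26's whole printed leaf at the record geometry, symmetric normalisation: down to six located binders -/

/-- ★ **(3.132) AS THE WHOLE PRINTED LEAF `B9.Stmt3132Printed` AT THE RECORD GEOMETRY `geo9Y`, FROM COERCIVITY + DECAY + THE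
NORMALISATION READINGS ONLY** (symmetric normalisation `w(y) = (Lʲη)^{−(1+d′∕2)}` for both kernels): `CoerciveUnder` and `DecayUnder` for
the normalised matrices `S` of QGQ\* and `S₁` of QG₁Q\*, and `B9Eq3132Whole.InvNormalised` for the two kernels with the symmetric
weights, give `B9.Stmt3132Printed d′ c35 geo9Y bg QGQinv QG₁Qinv` — `B9Eq3132Whole.stmt3132Printed_of_coercive` (p462308) with its
Combes–Thomas inputs from §4, its four carrier facts from `geo9Y_dist_comm ∕ _self ∕ _triangle ∕ geo9Y_len_pos`, and its weights
transfer ∕ `0 < A` from `hwt_symm_geo9Y d′` ∕ `symmA_pos d′` (A = L^{|(d′−2)∕2|}, [4] (2.60)).  In the N06 knit (`s3132`, any `ops`, `QGQinv :=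
fun x => (ops x).QGQinv`): six binders of located shape remain (`hco hdec hco₁ hdec₁` — Thm 3.11-type positivity ∕ Thm 3.3-type decay
of the normalised QGQ\*, QG₁Q\*; `hN hN₁` — the instance's normalisation readings), nothing geometric.  Nothing of print asserted.
[cite: Balaban1985BackgroundPropagators, (3.132) p.422 + Thm 3.12 p.423 (prefix); Balaban1984PropagatorsII, Lemma 2.1 (2.60)–(2.61) p.234] -/
theorem stmt3132Printed_geo9Y_of_coercive_decay (dd : ℕ) [∀ x : MemberY d ℓ hd hL b₀ b₁ Mstar, Fintype (geo9Y x).Site]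
    [∀ x : MemberY d ℓ hd hL b₀ b₁ Mstar, DecidableEq (geo9Y x).Site] {c35 : ℝ}
    {bg : MemberY d ℓ hd hL b₀ b₁ Mstar → B9.Backgrounds}
    {QGQinv QG₁Qinv : ∀ x : MemberY d ℓ hd hL b₀ b₁ Mstar, B9.SiteKernel (geo9Y x) (bg x)}
    {S S₁ : ∀ x : MemberY d ℓ hd hL b₀ b₁ Mstar, (bg x).Cfg → Matrix (geo9Y x).Site (geo9Y x).Site ℝ}
    (hco : CoerciveUnder c35 geo9Y bg S) (hdec : DecayUnder c35 geo9Y bg S)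
    (hco₁ : CoerciveUnder c35 geo9Y bg S₁) (hdec₁ : DecayUnder c35 geo9Y bg S₁)
    (hN : ∀ x : MemberY d ℓ hd hL b₀ b₁ Mstar,
      InvNormalised (QGQinv x) (S x) (fun y => (geo9Y x).len y ^ (-(1 + (dd : ℝ) / 2))))
    (hN₁ : ∀ x : MemberY d ℓ hd hL b₀ b₁ Mstar,
      InvNormalised (QG₁Qinv x) (S₁ x) (fun y => (geo9Y x).len y ^ (-(1 + (dd : ℝ) / 2)))) :
    B9.Stmt3132Printed dd c35 (geo9Y (d := d) (ℓ := ℓ) (hd := hd) (hL := hL) (b₀ := b₀) (b₁ := b₁) (Mstar := Mstar)) bg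
      QGQinv QG₁Qinv :=
  stmt3132Printed_of_coercive dd (ctInputs_geo9Y_of_coercive_decay hco hdec) (ctInputs_geo9Y_of_coercive_decay hco₁ hdec₁)
    hN hN₁ (fun x y y' => geo9Y_dist_comm x y y') (fun x y => geo9Y_dist_self x y)
    (fun x a b c => geo9Y_dist_triangle x a b c) (fun x y => (geo9Y_len_pos x y).le) (symmA_pos dd)
    (hwt_symm_geo9Y (d := d) (ℓ := ℓ) (hd := hd) (hL := hL) (b₀ := b₀) (b₁ := b₁) (Mstar := Mstar) dd)

end Record

end

end Literature.MathematicalPhysics.QuantumFieldTheory.Balaban1983to89.B9Eq3132CTInputs
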